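import Literature.Barriers.FinalStateConjecture.HairyKerrBifurcation
import HarnessLib

/-!
# Barrier catalogue `FinalStateConjecture`: linear hair — exactly time-periodic Klein–Gordon bound states on rotating Kerr (Shlapentokh-Rothman's real modes, the linear input of Chodosh–Shlapentokh-Rothman)
(`Literature/Barriers/FinalStateConjecture/`, D-0021; family `gr`, summit `FinalStateConjecture`;
sibling of `HairyKerrBifurcation.lean` and `KleinGordonSuperradiantInstability.lean`;
namespace `Literature.Barriers.FinalStateConjecture`)

This file vendors, as a **named fact** (D-0014), the existence of REAL-frequency, smooth,
finite-energy mode solutions of the massive Klein–Gordon equation on every rotating sub-extremal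
Kerr exterior — Y. Shlapentokh-Rothman, *Exponentially growing finite energy solutions for the
Klein–Gordon equation on sub-extremal Kerr spacetimes*, Comm. Math. Phys. 329 (2014) 859–891,
Thm. 1.2 at `ε = 0` together with Thm. 1.3 (i) (p. 5 of the held copy `paper:arxiv-1302.3448`):
"Fix a sub-extremal Kerr spacetime with mass `M` and angular momentum `aM`. Let `m ∈ ℤ` and
`ω₀ ∈ ℝ` satisfy `am − 2Mr₊ω₀ = 0` and `am ≠ 0`. Then, for each `l` and sufficiently small
`δ > 0`, there exists `μ(0) > |ω_R(0)|`, real analytic `ω_R(ε)`, and real analytic `μ(ε)` such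
that for every `−δ < ε < δ`, there exists a mode solution with parameters
`(ω_R(ε) + iε, m, l, μ(ε))`" — a "mode solution" being `ψ = e^{−iωt} e^{imφ} S_{ml}(θ) R(r)` in
Boyer–Lindquist coordinates which "solves the Klein–Gordon equation, extends smoothly to the
horizon [...], and has finite energy" (§1.3, p. 5) — and Thm. 1.3: "Suppose there exists a mode
solution with parameters `(ω, m, l, μ)` such that `ω ∈ ℝ` and `μ² > ω²`. Then [...] we have
`am − 2Mr₊ω = 0`. We have `am ≠ 0`", so that the `ε = 0` member is an exactly time-periodic
solution of frequency `ω₀ = am/(2Mr₊)` and mass `μ(0) > |ω₀|`: "bound state solutions which have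
exactly zero energy flux on the horizon. As one expects, these solutions will neither grow nor
decay" (§1, p. 4). Chodosh–Shlapentokh-Rothman restate it as their Thm. 1.3 (CMP 356 (2017),
§1.1.1, p. 5): "for every choice of parameters `(a, M)` satisfying `0 < |a| < M` there exists a
countable sequence of masses `μ²` such that there exist exactly time-periodic solutions to the
corresponding Klein–Gordon equation", and call it the **linear hair** which their Thm. 1.1
(`HairyKerrBifurcation`) "can be interpreted as showing that this 'linear hair' can be
integrated to yield 'nonlinear hair'" (Rmk. 1.2, p. 4).

* `IsLinearHair M a μ ϖ Ψ` — a smooth complex field `Ψ ≢ 0` on the exterior chart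
  `Kerr.exterior M a` solving `□_{g_{M,a}} Ψ = μ² Ψ` (real and imaginary parts, prelude
  `dalembertian` of the `C^∞` Kerr metric `Kerr.smoothMetric M a r₊`) and time-periodic with
  frequency `ϖ` under the stationary flow (`IsTimePeriodicField` of the sibling file:
  `Ψ ∘ φ_s = e^{−iϖs} Ψ`) — exactly the data of `Ψ̂` in clause (4) of CSR Thm. 1.1.
* `KerrLinearHair` — **the barrier declaration** (structured block in its docstring).
* Proved: the modulus of a time-periodic field is invariant under the flow
  (`IsTimePeriodicField.norm_timeTranslate`), so a linear hair does not decay along the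
  stationary flow (`IsLinearHair.exists_not_tendsto_zero`; SR §1: "neither grow nor decay");
  nonlinear hair yields linear hair (`IsHairyKerrFamily.exists_isLinearHair`,
  `HairyKerrBifurcation.exists_isLinearHair`: clause (4) of CSR Thm. 1.1, Rmk. 1.2); and the
  consequence `KerrLinearHair.exists_nondecaying`.

## Rendering on the prelude (conventions of the two sibling files)

Carrier `Kerr.exterior M a = {r > r₊}` in the ingoing Kerr–Schild Cartesian chart (model
`𝓘(ℝ, E4)`), metric `Kerr.smoothMetric M a r₊`, instance hypotheses `[Kerr.Facts]
[Kerr.SliceFacts]` (the metric and its Levi-Civita connection). SR's modes are written in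
Boyer–Lindquist `(t, r, θ, φ)`; on the open exterior these differ from the prelude coordinates
by `t_KS = t + f(r)`, `φ_KS = φ + h(r)`, so `∂_t = ∂_{t_KS} = Kerr.stationaryField` (SR §1.2.1,
p. 4: "`∂_t` in Boyer–Lindquist coordinates is equal to `∂_{t*}` in Kerr-star coordinates";
module docstring of `KleinGordonSuperradiantInstability.lean`) and a real mode reads
`e^{−iω₀ t_KS} · Φ(x⃗)` with `Φ` smooth on the open exterior (`e^{imφ}S_{ml}` is smooth on `𝕊²`,
§2, p. 7; `R` is smooth on `(r₊, ∞)`): it transforms under the `t_KS`-translation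
`Kerr.timeTranslate` by the phase `e^{−iω₀s}`, which is `IsTimePeriodicField … ω₀`. The
frequency is recorded through `|ϖ| = |am|/(2Mr₊)` only, which does not depend on the
orientation conventions for `a` and `φ`; the mass clause `μ(0) > |ω_R(0)|` is recorded as
`|am|/(2Mr₊) < μ`. Real and imaginary parts of a complex solution are real solutions
(`dalembertian` is real-linear), as in `IsHairyKerrFamily.field_hasDeriv`.

## Role in the decomposition of `HairyKerrBifurcation` (provefact triage: XL)

The printed proof of CSR Thm. 1.1 is a fixed-point construction for the reduced stationary
axisymmetric Einstein–Klein–Gordon system (CSR §§3–13) whose two external inputs are the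
Carter–Robinson/Weinstein reduction (§2.1) and the real modes above (§2.2, revisited in §11 for
perturbed metrics). Of these, only the present statement is an independently published theorem
expressible on the prelude carrier; it is the leaf `Ψ̂` of clause (4). The nonlinear step (CSR
Thm. 13.1 and §13.4) is not vendored separately: it is the content of `HairyKerrBifurcation`
itself.

## Not vendored

The mode form and separation of variables, the index `l` (countably many masses for each `m`),
finiteness of the Klein–Gordon energy and the exponential decay of `R` at infinity (§2, p. 8),
the smooth extension to `𝓗⁺`, the analytic families `ω_R(ε)`, `μ(ε)` and the growing modes
`ε > 0` (Thm. 1.2; vendored in existence form by `KleinGordonSuperradiantInstability`), and the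
necessity statements Thm. 1.3 (ii)–(iii) (`am ≠ 0`; `ω² < μ² < ω² + C(m, l)`).

## References

* Y. Shlapentokh-Rothman, Comm. Math. Phys. 329 (2014) 859–891 (arXiv:1302.3448): §1 and
  §1.2.1 (p. 4), §1.3 with Thms. 1.2–1.3 (p. 5), §2 (pp. 7–8) — pages of the held store copy.
* O. Chodosh, Y. Shlapentokh-Rothman, Comm. Math. Phys. 356 (2017) 1155–1250
  (arXiv:1510.08025): Thm. 1.1 (4), Rmks. 1.2 and 1.4 (p. 4), §1.1.1 (Thms. 1.2–1.3, p. 5),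
  §2.2 (pp. 7–8).
* M. Dafermos, I. Rodnianski, Y. Shlapentokh-Rothman, Ann. of Math. 183 (2016) 787–913
  (arXiv:1402.7034), Thm. 3.1 (boundedness and integrated local energy decay for the massless
  equation on the full sub-extremal range; quoted as CSR Thm. 1.2).
-/

noncomputable section

open Set Filter Topology
open scoped Manifold ContDiff

namespace Literature.Barriers.FinalStateConjecture

open Literature.Geometry.Lorentzian

/-! ### Time-periodic fields do not decay along the stationary flow -/

/-- A time-periodic field has flow-invariant modulus: `‖Ψ(φ_s x)‖ = ‖Ψ(x)‖` (the phase
`e^{−iϖs}` is unimodular) — "these solutions will neither grow nor decay" (Shlapentokh-Rothman,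
CMP 329 (2014), §1, p. 4, of the real modes). [cite: ShlapentokhRothman2014KleinGordon, §1 (p. 4)] -/
theorem IsTimePeriodicField.norm_timeTranslate {a r₀ ϖ : ℝ} {Ψ : Kerr.region a r₀ → ℂ}
    (hΨ : IsTimePeriodicField a r₀ Ψ ϖ) (s : ℝ) (x : Kerr.region a r₀) :
    ‖Ψ (Kerr.timeTranslate a r₀ s x)‖ = ‖Ψ x‖ := by
  rw [hΨ, norm_mul, ← Complex.ofReal_neg, Complex.norm_exp_ofReal_mul_I, one_mul]

/-- A time-periodic field does not decay along the stationary flow through any point where it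
is non-zero: `Ψ(φ_s x) ↛ 0` as `s → +∞` (its modulus is the constant `‖Ψ x‖ ≠ 0`).
Shlapentokh-Rothman, CMP 329 (2014), §1 (p. 4). [cite: ShlapentokhRothman2014KleinGordon, §1 (p. 4)] -/
theorem IsTimePeriodicField.not_tendsto_zero {a r₀ ϖ : ℝ} {Ψ : Kerr.region a r₀ → ℂ}
    (hΨ : IsTimePeriodicField a r₀ Ψ ϖ) {x : Kerr.region a r₀} (hx : Ψ x ≠ 0) :
    ¬ Tendsto (fun s : ℝ ↦ Ψ (Kerr.timeTranslate a r₀ s x)) atTop (𝓝 0) := by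
  intro h
  have h1 : Tendsto (fun s : ℝ ↦ ‖Ψ (Kerr.timeTranslate a r₀ s x)‖) atTop (𝓝 0) := by
    simpa using h.norm
  simp_rw [hΨ.norm_timeTranslate] at h1
  exact hx (norm_eq_zero.mp (tendsto_const_nhds_iff.mp h1))

/-! ### Linear hair (Shlapentokh-Rothman 2014; Chodosh–Shlapentokh-Rothman Thm. 1.3) -/

/-- **A linear hair on the Kerr exterior `{r > r₊}` of parameters `(M, a)`, with mass `μ` and
frequency `ϖ`:** a complex field `Ψ` on `Kerr.exterior M a` which is not identically zero, is
`C^∞`, solves the Klein–Gordon equation `□_{g_{M,a}} Ψ = μ² Ψ` (real and imaginary parts, for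
the `C^∞` Kerr metric `Kerr.smoothMetric M a r₊` and the prelude `dalembertian`), and is
time-periodic with frequency `ϖ` under the stationary flow, `Ψ ∘ φ_s = e^{−iϖs} Ψ`
(`IsTimePeriodicField`). This is the datum `Ψ̂` of clause (4) of Chodosh–Shlapentokh-Rothman's
Thm. 1.1 ("a non-zero time-periodic solution to the Klein–Gordon equation on `(𝓜, g_0)`",
CMP 356 (2017), p. 4; "linear hair", Rmk. 1.2), i.e. a real mode of Shlapentokh-Rothman
(CMP 329 (2014), §1.3) read on the prelude chart (module docstring). Instance hypotheses
`[Kerr.Facts] [Kerr.SliceFacts]` as in `IsHairyKerrFamily`.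
[cite: ChodoshShlapentokhrothman2017, Thm. 1.1 (4) and Rmk. 1.2] -/
structure IsLinearHair [Kerr.Facts] [Kerr.SliceFacts] (M a μ ϖ : ℝ) (Ψ : Kerr.exterior M a → ℂ) :
    Prop where
  /-- `Ψ` is not identically zero. -/
  nonzero : ∃ x, Ψ x ≠ 0
  /-- `Ψ` is smooth. -/
  smooth : ContMDiff 𝓘(ℝ, E4) 𝓘(ℝ, ℂ) ∞ Ψ
  /-- `□_g (Re Ψ) = μ² Re Ψ`. -/
  kleinGordon_re : ∀ x, (Kerr.smoothMetric M a (Kerr.rPlus M a)).dalembertian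
    (fun y ↦ (Ψ y).re) x = μ ^ 2 * (Ψ x).re
  /-- `□_g (Im Ψ) = μ² Im Ψ`. -/
  kleinGordon_im : ∀ x, (Kerr.smoothMetric M a (Kerr.rPlus M a)).dalembertian
    (fun y ↦ (Ψ y).im) x = μ ^ 2 * (Ψ x).im
  /-- `Ψ ∘ φ_s = e^{−iϖs} Ψ` for all `s`. -/
  periodic : IsTimePeriodicField a (Kerr.rPlus M a) Ψ ϖ

namespace IsLinearHair

variable [Kerr.Facts] [Kerr.SliceFacts] {M a μ ϖ : ℝ} {Ψ : Kerr.exterior M a → ℂ}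

/-- A linear hair does not decay along the stationary flow: through some point,
`Ψ(φ_s x) ↛ 0` as `s → +∞` — "these solutions will neither grow nor decay" (Shlapentokh-Rothman,
CMP 329 (2014), §1, p. 4); "the natural analogue of the type of solution we construct in
Theorem 1.1 cannot exist when `μ = 0`" (Chodosh–Shlapentokh-Rothman, CMP 356 (2017), §1.1.1,
p. 5). [cite: ShlapentokhRothman2014KleinGordon, §1 (p. 4)] -/
theorem exists_not_tendsto_zero (h : IsLinearHair M a μ ϖ Ψ) :
    ∃ x : Kerr.exterior M a,
      ¬ Tendsto (fun s : ℝ ↦ Ψ (Kerr.timeTranslate a _ s x)) atTop (𝓝 0) := by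
  obtain ⟨x, hx⟩ := h.nonzero
  exact ⟨x, h.periodic.not_tendsto_zero hx⟩

/-- A linear hair with non-zero frequency is not stationary: `Ψ ∘ φ_s ≠ Ψ` for some `s`
(Chodosh–Shlapentokh-Rothman, CMP 356 (2017), Thm. 1.1 (4): "a non-zero time-periodic
solution"). [cite: ChodoshShlapentokhrothman2017, Thm. 1.1 (4)] -/
theorem exists_ne (h : IsLinearHair M a μ ϖ Ψ) (hϖ : ϖ ≠ 0) :
    ∃ (s : ℝ) (x : Kerr.exterior M a), Ψ (Kerr.timeTranslate a _ s x) ≠ Ψ x := by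
  obtain ⟨x, hx⟩ := h.nonzero
  obtain ⟨s, hs⟩ := h.periodic.exists_ne hϖ hx
  exact ⟨s, x, hs⟩

end IsLinearHair

/-- The superradiant threshold frequency is non-zero on rotating sub-extremal Kerr:
`|am|/(2Mr₊) > 0` for `0 < |a| < M` and `m ≠ 0` (here `0 ≤ r₋ < r₊`). Shlapentokh-Rothman,
CMP 329 (2014), Thm. 1.3 (ii) (`am ≠ 0`). [cite: ShlapentokhRothman2014KleinGordon, Thm. 1.3] -/
theorem superradiantThreshold_pos {M a : ℝ} (hMa : Kerr.IsSubextremal M a) (ha : a ≠ 0) {m : ℤ}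
    (hm : m ≠ 0) : 0 < |a * m| / (2 * M * Kerr.rPlus M a) := by
  have hr : 0 < Kerr.rPlus M a := hMa.rMinus_nonneg.trans_lt hMa.rMinus_lt_rPlus
  have hM : 0 < M := hMa.pos
  have hnum : 0 < |a * (m : ℝ)| := abs_pos.mpr (mul_ne_zero ha (Int.cast_ne_zero.mpr hm))
  positivity

/-- **Barrier (linear hair; Shlapentokh-Rothman's real modes): on every sub-extremal Kerr
exterior with `a ≠ 0` and for every non-zero azimuthal number `m` there are a mass
`μ > |am|/(2Mr₊)` and a smooth, non-zero, exactly time-periodic solution of the Klein–Gordon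
equation `(□_g − μ²)Ψ = 0` with frequency `|ω₀| = |am|/(2Mr₊)` — a solution which neither
grows nor decays.** Shlapentokh-Rothman, Comm. Math. Phys. 329 (2014), Thm. 1.2 (the member
`ε = 0`: a mode solution with parameters `(ω_R(0), m, l, μ(0))`, `μ(0) > |ω_R(0)|`) with
Thm. 1.3 (i) (`am − 2Mr₊ω = 0` for every real mode with `μ² > ω²`), quoted in the module
docstring; = Chodosh–Shlapentokh-Rothman, CMP 356 (2017), Thm. 1.3 ("there exists a countable
sequence of masses `μ²` such that there exist exactly time-periodic solutions").
**Vendored form** (module docstring): for `[Kerr.Facts] [Kerr.SliceFacts]`, `Kerr.IsSubextremal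
M a`, `a ≠ 0`, `m ∈ ℤ ∖ {0}`: `∃ μ > |am|/(2Mr₊)`, `∃ ϖ` with `|ϖ| = |am|/(2Mr₊)`, `∃ Ψ` with
`IsLinearHair M a μ ϖ Ψ`.

BARRIER (D-0021; every clause is a quotation or close paraphrase of the cited locus):
* technique_class: mass-insensitive decay arguments — any proof of decay (even non-quantitative decay to zero on compact sets, a fortiori Price-law or integrated-energy-decay statements) for the wave equation on Kerr `a ≠ 0`, or any linear step of a Kerr stability / final-state argument (`Literature.Geometry.Lorentzian.Development.SettlesToKerrFamily`), that would apply verbatim to `(□_g − μ²)Ψ = 0` with a mass `μ > 0` in the certified range; real-frequency (threshold) counterpart of `KleinGordonSuperradiantInstability` and linear counterpart of `HairyKerrBifurcation`.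
* blocks: decay-to-zero for massive scalar fields on rotating Kerr with these masses — the massless theorem "finite energy solutions to the wave equation have uniformly bounded energy and satisfy an integrated energy decay statement" "is easily seen to imply that any finite energy solution to the wave equation decays to `0` on any compact set; in particular, the natural analogue of the type of solution we construct [...] cannot exist when `μ = 0`" [cite: ChodoshShlapentokhrothman2017, §1.1.1 (Thm. 1.2 and after)]; for Klein–Gordon "the answer is emphatically 'no'": "there exists a countable sequence of masses `μ²` such that there exist exactly time-periodic solutions" [cite: ChodoshShlapentokhrothman2017, §1.1.1 (Thm. 1.3)]; these solutions are the "linear hair" which "can be integrated to yield 'nonlinear hair'" (`HairyKerrBifurcation`) [cite: ChodoshShlapentokhrothman2017, Rmk. 1.2].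
* because: the solutions are real modes `e^{−iω₀t}e^{imφ}S_{ml}(θ)R(r)`, `am − 2Mr₊ω₀ = 0`, `am ≠ 0`, `μ² > ω₀²` [cite: ShlapentokhRothman2014KleinGordon, Thms. 1.2–1.3]: bound states ("the solution will spatially decay exponentially fast so that no energy is radiated away to infinity"; `R` "is exponentially decaying at infinity") with "exactly zero energy flux on the horizon" — "`am − 2Mr₊ω = 0 ⇔ Vψ = 0 ⇔` No energy flux along the horizon", `V = T + (a/(2Mr₊))Φ` the horizon generator — "precisely at the threshold of superradiance"; they are constructed variationally, treating "the Klein–Gordon mass as an eigenvalue" [cite: ShlapentokhRothman2014KleinGordon, §1 (p. 4), §1.3 (p. 5) and §2 (p. 8)] [cite: ChodoshShlapentokhrothman2017, §1.1.1 and §2.2].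
* evasions_known: the massless equation `μ = 0`: boundedness and integrated decay on the full sub-extremal range [cite: DafermosRodnianskiShlapentokhrothman2014, Thm. 3.1] [cite: ChodoshShlapentokhrothman2017, Thm. 1.2]; Schwarzschild `a = 0` and axisymmetric fields `m = 0`: no real bound-state modes ("We have `am ≠ 0`"; "It is not possible for the Schwarzschild solution to bifurcate in this manner, even at the linear level") [cite: ShlapentokhRothman2014KleinGordon, Thm. 1.3] [cite: ChodoshShlapentokhrothman2017, Rmk. 1.4]; masses outside the window `ω₀² < μ² < ω₀² + C(m, l)`, `C(m, l) → 0` as `l → ∞`, carry no real bound-state mode with these parameters [cite: ShlapentokhRothman2014KleinGordon, Thm. 1.3].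
* scope_caveats: (a) existence for PARTICULAR masses only — for each `m ≠ 0` (and each `l`, not vendored) one mass `μ(0)` with `μ(0)² ∈ (ω₀², ω₀² + C(m, l))`, `ω₀ = am/(2Mr₊)`; nothing is asserted for other masses, for `μ = 0`, for `a = 0` or `|a| ≥ M` [cite: ShlapentokhRothman2014KleinGordon, Thms. 1.2–1.3]; (b) existence form on the open exterior chart: smoothness, the equation, non-vanishing and the phase law under the `t_KS`-flow with `|ϖ| = |am|/(2Mr₊)`; finite energy, exponential spatial decay, the smooth extension to `𝓗⁺` and the mode structure are NOT vendored, and the identification `∂_t = ∂_{t_KS}`, `t`-flow = `Kerr.timeTranslate` is argued in the module docstring, not proved; (c) a LINEAR statement on a FIXED Kerr background — no claim about the vacuum equations or about nonlinear dynamics (for the Einstein–Klein–Gordon upgrade see `HairyKerrBifurcation`) [cite: ShlapentokhRothman2014KleinGordon, abstract]; (d) the printed uniqueness/necessity parts of Thm. 1.3 are quoted in `evasions_known` only, not vendored.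
* status: established — theorem [cite: ShlapentokhRothman2014KleinGordon, Thms. 1.2–1.3]. -/
def KerrLinearHair : Prop :=
  ∀ [Kerr.Facts] [Kerr.SliceFacts] (M a : ℝ), Kerr.IsSubextremal M a → a ≠ 0 →
    ∀ m : ℤ, m ≠ 0 →
      ∃ μ : ℝ, |a * m| / (2 * M * Kerr.rPlus M a) < μ ∧
        ∃ (ϖ : ℝ) (Ψ : Kerr.exterior M a → ℂ),
          |ϖ| = |a * m| / (2 * M * Kerr.rPlus M a) ∧ IsLinearHair M a μ ϖ Ψ

/-- Under the fact: on every rotating sub-extremal Kerr exterior there are a mass `μ > 0` and a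
smooth non-zero solution of `□_g Ψ = μ² Ψ` which is time-periodic with a NON-ZERO frequency,
hence not stationary and not decaying along the stationary flow — the "exactly time-periodic
solutions" of Chodosh–Shlapentokh-Rothman's Thm. 1.3 which "cannot exist when `μ = 0`"
(CMP 356 (2017), §1.1.1, p. 5). [cite: ChodoshShlapentokhrothman2017, §1.1.1 (Thms. 1.2–1.3)] -/
theorem KerrLinearHair.exists_nondecaying (h : KerrLinearHair) [Kerr.Facts] [Kerr.SliceFacts]
    {M a : ℝ} (hMa : Kerr.IsSubextremal M a) (ha : a ≠ 0) :
    ∃ (μ ϖ : ℝ) (Ψ : Kerr.exterior M a → ℂ), 0 < μ ∧ ϖ ≠ 0 ∧ IsLinearHair M a μ ϖ Ψ ∧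
      (∃ (s : ℝ) (x : Kerr.exterior M a), Ψ (Kerr.timeTranslate a _ s x) ≠ Ψ x) ∧
      ∃ x : Kerr.exterior M a,
        ¬ Tendsto (fun s : ℝ ↦ Ψ (Kerr.timeTranslate a _ s x)) atTop (𝓝 0) := by
  obtain ⟨μ, hμ, ϖ, Ψ, hϖ, hΨ⟩ := h M a hMa ha 1 one_ne_zero
  have hpos := superradiantThreshold_pos hMa ha (one_ne_zero (α := ℤ))
  have hϖ0 : ϖ ≠ 0 := abs_pos.mp (hϖ ▸ hpos)
  exact ⟨μ, ϖ, Ψ, hpos.trans hμ, hϖ0, hΨ, hΨ.exists_ne hϖ0, hΨ.exists_not_tendsto_zero⟩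

/-! ### Nonlinear hair yields linear hair (CSR Thm. 1.1 (4), Rmk. 1.2) -/

/-- **The `δ`-derivative of a hairy Kerr family is a linear hair.** For a family as in
`IsHairyKerrFamily`, the limit `Ψ̂ = lim_{δ→0} δ⁻¹Ψ_δ` is a smooth, non-zero, time-periodic
(non-zero frequency) solution of the Klein–Gordon equation of mass `μ²` on the reference Kerr
exterior. Chodosh–Shlapentokh-Rothman, CMP 356 (2017), Thm. 1.1 (4) and Rmk. 1.2.
[cite: ChodoshShlapentokhrothman2017, Thm. 1.1 (4) and Rmk. 1.2] -/
theorem IsHairyKerrFamily.exists_isLinearHair [Kerr.Facts] [Kerr.SliceFacts] {M a ε μ : ℝ}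
    {g : ℝ → LorentzianMetric 𝓘(ℝ, E4) ∞ (Kerr.exterior M a)} {Ψ : ℝ → Kerr.exterior M a → ℂ}
    (h : IsHairyKerrFamily M a ε μ g Ψ) :
    ∃ (ϖ : ℝ) (Ψhat : Kerr.exterior M a → ℂ), ϖ ≠ 0 ∧ IsLinearHair M a μ ϖ Ψhat ∧
      ∀ x, HasDerivWithinAt (fun δ ↦ Ψ δ x) (Ψhat x) (Ici 0) 0 := by
  obtain ⟨Ψhat, hne, hsmooth, hre, him, ⟨ϖ, hϖ, hper⟩, hder⟩ := h.field_hasDeriv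
  exact ⟨ϖ, Ψhat, hϖ, ⟨hne, hsmooth, hre, him, hper⟩, hder⟩

/-- **Nonlinear hair yields linear hair.** Given `HairyKerrBifurcation`, some rotating
sub-extremal Kerr exterior carries, for some mass `μ > 0`, a linear hair with non-zero
frequency (the `δ`-derivative `Ψ̂` of the bifurcating family). Chodosh–Shlapentokh-Rothman,
CMP 356 (2017), Thm. 1.1 (4) and Rmk. 1.2 ("this 'linear hair' can be integrated to yield
'nonlinear hair'"). [cite: ChodoshShlapentokhrothman2017, Thm. 1.1 (4) and Rmk. 1.2] -/
theorem HairyKerrBifurcation.exists_isLinearHair (h : HairyKerrBifurcation) [Kerr.Facts]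
    [Kerr.SliceFacts] :
    ∃ (M a μ ϖ : ℝ) (Ψhat : Kerr.exterior M a → ℂ),
      Kerr.IsSubextremal M a ∧ a ≠ 0 ∧ 0 < μ ∧ ϖ ≠ 0 ∧ IsLinearHair M a μ ϖ Ψhat := by
  obtain ⟨M, a, ε, μ, g, Ψ, hf⟩ := h
  obtain ⟨ϖ, Ψhat, hϖ, hlin, -⟩ := hf.exists_isLinearHair
  exact ⟨M, a, μ, ϖ, Ψhat, hf.isSubextremal.1, hf.isSubextremal.2, hf.param.2.2.2, hϖ, hlin⟩

end Literature.Barriers.FinalStateConjecture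

end
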